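import Summits.ABC.IUTFork.Joshi.TestGenuinePinsDividingLine
import Literature.IUT.LogVolume.FixedBallShapesDiscriminant
import HarnessLib

/-!
# Branch E TEST — the genuine-carrier pins force `|d_F| ≤ 12^{⌊[F:ℚ]/2⌋}` (R-J row Y-26, rider R-23b «discriminant degree cut»)

Proof-only sequel (abc-iut cell, D-0079 R-J «Joshi Y-discharge census», row Y-26; seat abc-iut-E-t32, gen 11; 0 definitions, no `Prop`
fact, FACT rows used: none; abc-iut-E-plan's ruling 2026-08-27T03:43:40Z, R-23b) to abc-iut-E-t41's `Joshi/TestGenuinePinsDividingLine.lean`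
(p489924, (B2) `localShape_of_pinnedRegions_settingPrVolSharp`: THE FIXED-BALL SHAPE LIST IS EXHAUSTIVE) and this seat's classical files
`Literature/IUT/LogVolume/WildQuadraticDyadicDifferent.lean` (p493580: the `ℚ₂(√3)`-shaped wild quadratic dyadic place has `d_v = 1`,
i.e. different exponent `δ_v = 2`, PROVED) and `Literature/IUT/LogVolume/FixedBallShapesDiscriminant.lean` (p494173: fixed-ball shapes
at every finite place ⇒ `|d_F| = 4^{#A}·3^{#B} ≤ 12^{⌊n/2⌋}`, `A`/`B` = ramified places over `2`/`3`).  THIS FILE composes them BY NAME: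

* `fixedBallShapes_two/three/other_of_pinnedRegions_settingPrVolSharp` — `PinnedRegions` at abc-iut-c312-7's genuine carrier
  `settingPrVolSharp` (analytic logarithms; any `X`, `ρ`, `qK`, column data, `Ψ`, ideles, column) puts EVERY finite place of `F` on the
  fixed-ball list, in the three-hypothesis form of `FixedBallShapesDiscriminant`;
* **`natAbs_discr_eq_of_pinnedRegions_settingPrVolSharp`** — hence `|d_F| = 4^{#A}·3^{#B}` EXACTLY (`d_F` is `± 2^{2a}·3^{b}`);
* **`abs_discr_le_twelve_pow_of_pinnedRegions_settingPrVolSharp`** — and **`|d_F| ≤ 12^{⌊[F:ℚ]/2⌋}`** (the root discriminant of a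
  pinned `F` is `≤ 2√3`), with `2·#A ≤ [F:ℚ]`, `2·#B ≤ [F:ℚ]`;
* `not_pinnedRegions_settingPrVolSharp_of_twelve_pow_lt_abs_discr` (+ `PinnedRegions3` form) — CONTRAPOSITIVE: every number field with
  `12^{⌊[F:ℚ]/2⌋} < |d_F|` has KERNEL-EMPTY pins.  The exact Minkowski bound (Mathlib `NumberField.abs_discr_ge'`) supplies this
  hypothesis for `[F:ℚ] ∈ {3, 5, 7} ∪ [8, ∞)` (R-J row R-23a, abc-iut-f-072's numeric lemma family; NOT for `4`, `6`) — the DEGREE CUT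
  «pins ⇒ `[F:ℚ] ∈ {1, 2, 4, 6}`» is the composition of this file with R-23a, recorded where R-23a lands.

HONEST SCOPE: OUR interface's pins at OUR sharp real container under Dupuy–Hilado's typed (Ind2); nothing here bears on print's
(xi-e)/(xi-f); the emptiness of the located residual family (degrees `4`, `6`: Hunter / Pohst tables) is a PAPER statement not claimed
here; locates / conditionally verifies; no abc claim. [claim: Mochizuki2012, status: disputed]
[cite: DupuyHilado2025, §4.9] [cite: NeukirchANT1999, Ch. II Prop. (5.5), (6.8), Ch. III (2.9), (2.11)] [cite: SerreLocalFields1979, Ch. III §6 Prop. 13]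
-/

noncomputable section

open Set Function NumberField IsDedekindDomain Metric
open scoped Pointwise Classical

namespace Summit.ABC.IUTFork.Joshi

open Thm311 Thm311.Real Cor312 Cor312Vol Literature.IUT.LogThetaLattice Literature.IUT.LogVolume
  Literature.IUT.HodgeTheaters Literature.NumberTheory.NumberFields
open Literature.NumberTheory.GaloisRepresentations.Ultrametric
open GenuinePinsResidual GenuinePinsDividingLine

/-! ## 1. The pins put every finite place on the fixed-ball list -/

/-! ## 3. At `settingPrVolSharp`: positive information from the pins -/

variable {F : Type} [Field F] [NumberField F] (X : PilotData F)
  (M : Type) [Field M] [NumberField M]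
  (archPk : ∀ (j : (thetaIndex X).Label) (vQ : (thetaIndex X).VQ), Set ((logShellsDH X (analyticLogv F)).Packet j vQ))
  (archSub : ∀ (j : (thetaIndex X).Label) (v : (thetaIndex X).V),
    Set ((logShellsDH X (analyticLogv F)).Packet j ((thetaIndex X).over v)))
  (Ψ : ℤ → ∀ v : (thetaIndex X).V, v ∈ (thetaIndex X).Vbad → Set ((logShellsDH X (analyticLogv F)).StarPacket v))
  (act : ℤ → ∀ v : (thetaIndex X).V, v ∈ (thetaIndex X).Vbad →
    (logShellsDH X (analyticLogv F)).StarPacket v → Module.End ℚ ((logShellsDH X (analyticLogv F)).StarPacket v))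
  (Mmod : ℤ → ∀ j : (thetaIndex X).LabelStar, Set ((logShellsDH X (analyticLogv F)).GlobalPacket j.1))
  (region : ℤ → ∀ j : (thetaIndex X).LabelStar, FinDivisor M → ∀ vQ : (thetaIndex X).VQ,
    Set ((logShellsDH X (analyticLogv F)).Packet j.1 vQ))
  (frobAdm : ℤ → ℤ → ∀ (j : (thetaIndex X).Label) (vQ : (thetaIndex X).VQ),
    Set ((logShellsDH X (analyticLogv F)).Packet j vQ) → Prop)
  (frobLogvol : ℤ → ℤ → ∀ (j : (thetaIndex X).Label) (vQ : (thetaIndex X).VQ),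
    Set ((logShellsDH X (analyticLogv F)).Packet j vQ) → ℝ)
  (frobΨ : ℤ → ℤ → ∀ v : (thetaIndex X).V, v ∈ (thetaIndex X).Vbad → Set ((logShellsDH X (analyticLogv F)).StarPacket v))
  (frobMmod : ℤ → ℤ → ∀ j : (thetaIndex X).LabelStar, Set ((logShellsDH X (analyticLogv F)).GlobalPacket j.1))
  (unitImage : ℤ → ℤ → ℕ → ∀ (j : (thetaIndex X).Label) (vQ : (thetaIndex X).VQ),
    Set ((logShellsDH X (analyticLogv F)).Packet j vQ))
  (ballImage : ℤ → ℤ → ∀ (j : (thetaIndex X).Label) (vQ : (thetaIndex X).VQ),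
    Set ((logShellsDH X (analyticLogv F)).Packet j vQ))
  (thetaDiv : ℤ → ℤ → LgpDivisor M (thetaIndex X).lstar)
  (n : ℤ) {HT : Type} {LogLink : HT → HT → Type} {IsFull : ∀ {s t : HT}, LogLink s t → Prop}
  (lat : LGPGaussianLogThetaLattice LogLink IsFull)
  {Frd : Type} {IsoF : Frd → Frd → Type} {Ob : Frd → Type} {realify : Frd → Frd} {Strip : Type}
  {IsoS : Strip → Strip → Type} {Mv : ∀ v : (thetaIndex X).V, v ∈ (thetaIndex X).Vbad → Type}
  [∀ v h, Monoid (Mv v h)]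
  (sig : GlobalLGPFrobenioidSignature (thetaIndex X).lstar (thetaIndex X).V (· ∈ (thetaIndex X).Vbad)
    Frd IsoF Ob realify Strip IsoS Mv)
  (split : SplittingMonoids Mv) {ObΔ : Type} {N : ∀ v : (thetaIndex X).V, v ∈ (thetaIndex X).Vbad → Type}
  [∀ v h, Monoid (N v h)] (qData : QPilotData ObΔ N)
  (t : ∀ (pp : Nat.Primes) (_ : Fin X.lstar) (x : (thetaIndex X).Fibre (.inr pp)),
    haveI : Fact (pp : ℕ).Prime := ⟨pp.2⟩; kOf X pp.1 x)
  (tq : ∀ (pp : Nat.Primes) (x : (thetaIndex X).Fibre (.inr pp)), haveI : Fact (pp : ℕ).Prime := ⟨pp.2⟩; kOf X pp.1 x)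
  (ρ : (∀ v : (thetaIndex X).V, v ∈ (thetaIndex X).Vbad → Set ((logShellsDH X (analyticLogv F)).StarPacket v)) →
    ∀ (j : (thetaIndex X).Label) (vQ : (thetaIndex X).VQ), Set ((logShellsDH X (analyticLogv F)).Packet j vQ))
  (qK : ∀ v : (thetaIndex X).V, v ∈ (thetaIndex X).Vbad → Set ((logShellsDH X (analyticLogv F)).StarPacket v))
  (htq0 : ∀ pp x, tq pp x ≠ 0)
  (htq1 : ∀ (pp : Nat.Primes) (x : (thetaIndex X).Fibre (.inr pp)),
    haveI : Fact (pp : ℕ).Prime := ⟨pp.2⟩; placeOf X pp.1 x ∉ X.S → ‖tq pp x‖ = 1)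


/-- **Over `2`**: `PinnedRegions` at `settingPrVolSharp` ⇒ every `v ∣ 2` is `ℚ₂` (`e = 1`) or `ℚ₂(√3)`-shaped (`(e,f) = (2,1)`,
`log₂(𝒪_v^×) = 2𝒪_v`) — (B2) of p489924 read at `q = 2`. [cite: DupuyHilado2025, §4.9] [claim: Mochizuki2012, status: disputed] -/
theorem fixedBallShapes_two_of_pinnedRegions_settingPrVolSharp
    (hpin : Cor312Vol.PinnedRegions
      (LatticeSituation.ofShells (logShellsDH X (analyticLogv F)) M archPk archSub
        (summandPiecesPr X (logvAnalytic_analyticLogv (F := F))).Adm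
        (summandPiecesPr X (logvAnalytic_analyticLogv (F := F))).logvol Ψ act Mmod region frobAdm frobLogvol frobΨ frobMmod
        unitImage ballImage thetaDiv)
      (settingPrVolSharp X (logvAnalytic_analyticLogv (F := F)) M archPk archSub Ψ act Mmod region n lat sig split qData tq t
        htq0 htq1) ρ qK)
    (v : HeightOneSpectrum (𝓞 F)) (hv : ((2 : ℕ) : 𝓞 F) ∈ v.asIdeal) :
    v.asIdeal.ramificationIdx ℤ = 1 ∨
      (v.asIdeal.ramificationIdx ℤ = 2 ∧ v.asIdeal.inertiaDeg ℤ = 1 ∧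
        logUnits (RescaledCompletion F 2 v hv) =
          closedBall (0 : RescaledCompletion F 2 v hv) ‖(2 : RescaledCompletion F 2 v hv)‖) := by
  rcases localShape_of_pinnedRegions_settingPrVolSharp X M archPk archSub Ψ act Mmod region frobAdm frobLogvol frobΨ
      frobMmod unitImage ballImage thetaDiv n lat sig split qData t tq ρ qK htq0 htq1 hpin 2 v hv with
    ⟨he, -⟩ | ⟨h3, -⟩ | ⟨-, he, hf, -, hlog⟩
  · exact Or.inl he
  · exact absurd h3 (by decide)
  · exact Or.inr ⟨he, hf, hlog⟩

/-- **Over `3`**: `PinnedRegions` at `settingPrVolSharp` ⇒ every `v ∣ 3` is unramified or `ℚ₃(ζ₃)`-shaped (`(e,f) = (2,1)`) — (B2) at `q = 3`.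
[cite: DupuyHilado2025, §4.9] [claim: Mochizuki2012, status: disputed] -/
theorem fixedBallShapes_three_of_pinnedRegions_settingPrVolSharp
    (hpin : Cor312Vol.PinnedRegions
      (LatticeSituation.ofShells (logShellsDH X (analyticLogv F)) M archPk archSub
        (summandPiecesPr X (logvAnalytic_analyticLogv (F := F))).Adm
        (summandPiecesPr X (logvAnalytic_analyticLogv (F := F))).logvol Ψ act Mmod region frobAdm frobLogvol frobΨ frobMmod
        unitImage ballImage thetaDiv)
      (settingPrVolSharp X (logvAnalytic_analyticLogv (F := F)) M archPk archSub Ψ act Mmod region n lat sig split qData tq t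
        htq0 htq1) ρ qK)
    (v : HeightOneSpectrum (𝓞 F)) (hv : ((3 : ℕ) : 𝓞 F) ∈ v.asIdeal) :
    v.asIdeal.ramificationIdx ℤ = 1 ∨ (v.asIdeal.ramificationIdx ℤ = 2 ∧ v.asIdeal.inertiaDeg ℤ = 1) := by
  haveI : Fact (Nat.Prime 3) := ⟨Nat.prime_three⟩
  rcases localShape_of_pinnedRegions_settingPrVolSharp X M archPk archSub Ψ act Mmod region frobAdm frobLogvol frobΨ
      frobMmod unitImage ballImage thetaDiv n lat sig split qData t tq ρ qK htq0 htq1 hpin 3 v hv with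
    ⟨he, -⟩ | ⟨-, he, hf, -⟩ | ⟨h2, -⟩
  · exact Or.inl he
  · exact Or.inr ⟨he, hf⟩
  · exact absurd h2 (by decide)

/-- **Over `p ≥ 5`**: `PinnedRegions` at `settingPrVolSharp` ⇒ every place of residue characteristic `∉ {2, 3}` is unramified — (B2) at
`q = p_v`. [cite: DupuyHilado2025, §4.9] [claim: Mochizuki2012, status: disputed] -/
theorem fixedBallShapes_other_of_pinnedRegions_settingPrVolSharp
    (hpin : Cor312Vol.PinnedRegions
      (LatticeSituation.ofShells (logShellsDH X (analyticLogv F)) M archPk archSub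
        (summandPiecesPr X (logvAnalytic_analyticLogv (F := F))).Adm
        (summandPiecesPr X (logvAnalytic_analyticLogv (F := F))).logvol Ψ act Mmod region frobAdm frobLogvol frobΨ frobMmod
        unitImage ballImage thetaDiv)
      (settingPrVolSharp X (logvAnalytic_analyticLogv (F := F)) M archPk archSub Ψ act Mmod region n lat sig split qData tq t
        htq0 htq1) ρ qK)
    (v : HeightOneSpectrum (𝓞 F)) (h2 : residueChar F v ≠ 2) (h3 : residueChar F v ≠ 3) :
    v.asIdeal.ramificationIdx ℤ = 1 := by
  haveI : Fact (residueChar F v).Prime := ⟨residueChar_prime F v⟩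
  rcases localShape_of_pinnedRegions_settingPrVolSharp X M archPk archSub Ψ act Mmod region frobAdm frobLogvol frobΨ
      frobMmod unitImage ballImage thetaDiv n lat sig split qData t tq ρ qK htq0 htq1 hpin (residueChar F v) v (natCast_residueChar_mem F v) with
    ⟨he, -⟩ | ⟨h3', -⟩ | ⟨h2', -⟩
  · exact he
  · exact absurd h3' h3
  · exact absurd h2' h2

/-! ## 2. The discriminant of a pinned field -/

/-- **`PinnedRegions` at `settingPrVolSharp` ⇒ `|d_F| = 4^{#A}·3^{#B}`** (`A` = ramified places over `2`, `B` = over `3`): the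
discriminant of a pinned field is `± 2^{2a}·3^{b}`. [cite: NeukirchANT1999, Ch. III (2.9), (2.11)] [claim: Mochizuki2012, status: disputed] -/
theorem natAbs_discr_eq_of_pinnedRegions_settingPrVolSharp
    (hpin : Cor312Vol.PinnedRegions
      (LatticeSituation.ofShells (logShellsDH X (analyticLogv F)) M archPk archSub
        (summandPiecesPr X (logvAnalytic_analyticLogv (F := F))).Adm
        (summandPiecesPr X (logvAnalytic_analyticLogv (F := F))).logvol Ψ act Mmod region frobAdm frobLogvol frobΨ frobMmod
        unitImage ballImage thetaDiv)
      (settingPrVolSharp X (logvAnalytic_analyticLogv (F := F)) M archPk archSub Ψ act Mmod region n lat sig split qData tq t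
        htq0 htq1) ρ qK) :
    (NumberField.discr F).natAbs =
      4 ^ ((placesOver F 2).filter fun v => v.asIdeal.ramificationIdx ℤ = 2).card *
        3 ^ ((placesOver F 3).filter fun v => v.asIdeal.ramificationIdx ℤ = 2).card :=
  FixedBallShapes.natAbs_discr_eq F
    (fixedBallShapes_two_of_pinnedRegions_settingPrVolSharp X M archPk archSub Ψ act Mmod region frobAdm frobLogvol frobΨ
      frobMmod unitImage ballImage thetaDiv n lat sig split qData t tq ρ qK htq0 htq1 hpin)
    (fixedBallShapes_three_of_pinnedRegions_settingPrVolSharp X M archPk archSub Ψ act Mmod region frobAdm frobLogvol frobΨ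
      frobMmod unitImage ballImage thetaDiv n lat sig split qData t tq ρ qK htq0 htq1 hpin)
    (fixedBallShapes_other_of_pinnedRegions_settingPrVolSharp X M archPk archSub Ψ act Mmod region frobAdm frobLogvol frobΨ
      frobMmod unitImage ballImage thetaDiv n lat sig split qData t tq ρ qK htq0 htq1 hpin)

/-- `PinnedRegions` at `settingPrVolSharp` ⇒ `2·#A ≤ [F:ℚ]` (the ramified dyadic places have local degree `2`).
[cite: NeukirchANT1999, Ch. II Prop. (6.8)] [claim: Mochizuki2012, status: disputed] -/
theorem two_mul_card_ramifiedTwo_le_of_pinnedRegions_settingPrVolSharp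
    (hpin : Cor312Vol.PinnedRegions
      (LatticeSituation.ofShells (logShellsDH X (analyticLogv F)) M archPk archSub
        (summandPiecesPr X (logvAnalytic_analyticLogv (F := F))).Adm
        (summandPiecesPr X (logvAnalytic_analyticLogv (F := F))).logvol Ψ act Mmod region frobAdm frobLogvol frobΨ frobMmod
        unitImage ballImage thetaDiv)
      (settingPrVolSharp X (logvAnalytic_analyticLogv (F := F)) M archPk archSub Ψ act Mmod region n lat sig split qData tq t
        htq0 htq1) ρ qK) :
    2 * ((placesOver F 2).filter fun v => v.asIdeal.ramificationIdx ℤ = 2).card ≤ Module.finrank ℚ F :=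
  FixedBallShapes.two_mul_card_ramifiedTwo_le F
    (fixedBallShapes_two_of_pinnedRegions_settingPrVolSharp X M archPk archSub Ψ act Mmod region frobAdm frobLogvol frobΨ
      frobMmod unitImage ballImage thetaDiv n lat sig split qData t tq ρ qK htq0 htq1 hpin)

/-- `PinnedRegions` at `settingPrVolSharp` ⇒ `2·#B ≤ [F:ℚ]`. [cite: NeukirchANT1999, Ch. II Prop. (6.8)] [claim: Mochizuki2012, status: disputed] -/
theorem two_mul_card_ramifiedThree_le_of_pinnedRegions_settingPrVolSharp
    (hpin : Cor312Vol.PinnedRegions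
      (LatticeSituation.ofShells (logShellsDH X (analyticLogv F)) M archPk archSub
        (summandPiecesPr X (logvAnalytic_analyticLogv (F := F))).Adm
        (summandPiecesPr X (logvAnalytic_analyticLogv (F := F))).logvol Ψ act Mmod region frobAdm frobLogvol frobΨ frobMmod
        unitImage ballImage thetaDiv)
      (settingPrVolSharp X (logvAnalytic_analyticLogv (F := F)) M archPk archSub Ψ act Mmod region n lat sig split qData tq t
        htq0 htq1) ρ qK) :
    2 * ((placesOver F 3).filter fun v => v.asIdeal.ramificationIdx ℤ = 2).card ≤ Module.finrank ℚ F :=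
  FixedBallShapes.two_mul_card_ramifiedThree_le F
    (fixedBallShapes_three_of_pinnedRegions_settingPrVolSharp X M archPk archSub Ψ act Mmod region frobAdm frobLogvol frobΨ
      frobMmod unitImage ballImage thetaDiv n lat sig split qData t tq ρ qK htq0 htq1 hpin)

/-- **`PinnedRegions` at `settingPrVolSharp` ⇒ `|d_F| ≤ 12^{⌊[F:ℚ]/2⌋}`** (ℕ-division): the root discriminant of a pinned number field
is at most `2√3`. [cite: NeukirchANT1999, Ch. III (2.9), (2.11)] [cite: SerreLocalFields1979, Ch. III §6 Prop. 13] [claim: Mochizuki2012, status: disputed] -/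
theorem abs_discr_le_twelve_pow_of_pinnedRegions_settingPrVolSharp
    (hpin : Cor312Vol.PinnedRegions
      (LatticeSituation.ofShells (logShellsDH X (analyticLogv F)) M archPk archSub
        (summandPiecesPr X (logvAnalytic_analyticLogv (F := F))).Adm
        (summandPiecesPr X (logvAnalytic_analyticLogv (F := F))).logvol Ψ act Mmod region frobAdm frobLogvol frobΨ frobMmod
        unitImage ballImage thetaDiv)
      (settingPrVolSharp X (logvAnalytic_analyticLogv (F := F)) M archPk archSub Ψ act Mmod region n lat sig split qData tq t
        htq0 htq1) ρ qK) :
    |NumberField.discr F| ≤ 12 ^ (Module.finrank ℚ F / 2) :=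
  FixedBallShapes.abs_discr_le_twelve_pow F
    (fixedBallShapes_two_of_pinnedRegions_settingPrVolSharp X M archPk archSub Ψ act Mmod region frobAdm frobLogvol frobΨ
      frobMmod unitImage ballImage thetaDiv n lat sig split qData t tq ρ qK htq0 htq1 hpin)
    (fixedBallShapes_three_of_pinnedRegions_settingPrVolSharp X M archPk archSub Ψ act Mmod region frobAdm frobLogvol frobΨ
      frobMmod unitImage ballImage thetaDiv n lat sig split qData t tq ρ qK htq0 htq1 hpin)
    (fixedBallShapes_other_of_pinnedRegions_settingPrVolSharp X M archPk archSub Ψ act Mmod region frobAdm frobLogvol frobΨ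
      frobMmod unitImage ballImage thetaDiv n lat sig split qData t tq ρ qK htq0 htq1 hpin)

/-! ## 3. Contrapositive: a discriminant above `12^{⌊n/2⌋}` empties the pins -/

/-- **Every number field `F` with `12^{⌊[F:ℚ]/2⌋} < |d_F|` has KERNEL-EMPTY pins at `settingPrVolSharp`** (analytic logarithms, every `X`,
`ρ`, `qK`, column data, `Ψ`, ideles, column).  Mathlib's exact Minkowski bound `NumberField.abs_discr_ge'` supplies the hypothesis for
`[F:ℚ] ∈ {3, 5, 7} ∪ [8, ∞)` (R-J row R-23a). [cite: NeukirchANT1999, Ch. III (2.14)] [claim: Mochizuki2012, status: disputed] -/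
theorem not_pinnedRegions_settingPrVolSharp_of_twelve_pow_lt_abs_discr
    (hd : (12 : ℤ) ^ (Module.finrank ℚ F / 2) < |NumberField.discr F|) :
    ¬ Cor312Vol.PinnedRegions
      (LatticeSituation.ofShells (logShellsDH X (analyticLogv F)) M archPk archSub
        (summandPiecesPr X (logvAnalytic_analyticLogv (F := F))).Adm
        (summandPiecesPr X (logvAnalytic_analyticLogv (F := F))).logvol Ψ act Mmod region frobAdm frobLogvol frobΨ frobMmod
        unitImage ballImage thetaDiv)
      (settingPrVolSharp X (logvAnalytic_analyticLogv (F := F)) M archPk archSub Ψ act Mmod region n lat sig split qData tq t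
        htq0 htq1) ρ qK :=
  fun hpin => (abs_discr_le_twelve_pow_of_pinnedRegions_settingPrVolSharp X M archPk archSub Ψ act Mmod region frobAdm frobLogvol frobΨ
      frobMmod unitImage ballImage thetaDiv n lat sig split qData t tq ρ qK htq0 htq1 hpin).not_gt hd

/-- The same for `PinnedRegions3`. [claim: Mochizuki2012, status: disputed] -/
theorem not_pinnedRegions3_settingPrVolSharp_of_twelve_pow_lt_abs_discr
    (hd : (12 : ℤ) ^ (Module.finrank ℚ F / 2) < |NumberField.discr F|) :
    ¬ Cor312Vol.PinnedRegions3
      (LatticeSituation.ofShells (logShellsDH X (analyticLogv F)) M archPk archSub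
        (summandPiecesPr X (logvAnalytic_analyticLogv (F := F))).Adm
        (summandPiecesPr X (logvAnalytic_analyticLogv (F := F))).logvol Ψ act Mmod region frobAdm frobLogvol frobΨ frobMmod
        unitImage ballImage thetaDiv)
      (settingPrVolSharp X (logvAnalytic_analyticLogv (F := F)) M archPk archSub Ψ act Mmod region n lat sig split qData tq t
        htq0 htq1) ρ qK :=
  fun h => not_pinnedRegions_settingPrVolSharp_of_twelve_pow_lt_abs_discr X M archPk archSub Ψ act Mmod region frobAdm frobLogvol frobΨ
      frobMmod unitImage ballImage thetaDiv n lat sig split qData t tq ρ qK htq0 htq1 hd h.1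

end Summit.ABC.IUTFork.Joshi

end
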